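import Literature.MathematicalPhysics.QuantumFieldTheory.Balaban1983to89.B5Eq129FreeResolventKernelMonotone
import Literature.MathematicalPhysics.QuantumFieldTheory.Balaban1983to89.B5Eq129FreeResolventCycleProfile
import Literature.MathematicalPhysics.QuantumFieldTheory.Balaban1983to89.B5Eq129FreeResolventCycleComparison
import Literature.MathematicalPhysics.QuantumFieldTheory.Balaban1983to89.B5Eq129FreeResolventWeightedMarginal
import Literature.MathematicalPhysics.QuantumFieldTheory.Balaban1983to89.B5Eq129FreeResolventCycleWeightedTV
import Literature.MathematicalPhysics.QuantumFieldTheory.Balaban1983to89.B5Eq129CoshWeightFactorLetters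

/-!
# `Balaban1983to89.B5Eq129FreeResolventWeightedGradientRow` — T. Bałaban, *Propagators and renormalization transformations for lattice gauge
# theories. I*, Commun. Math. Phys. **95** (1984) 17–40 [Balaban1984PropagatorsI] (1.29) p. 23, p. 36 (exponential weights), serving
# [Balaban1985BackgroundPropagators] Thm 3.1 (3.42) p. 397 (the `|∇G|` line, flat case, WITH decay weights): **THE WEIGHTED ∇-ROW OF THE FREE MASSIVE
# RESOLVENT KERNEL ON ANY FINITE TORUS — `Σ_x φ(d_{N_ν}(x_ν))Φ(x)|k(x − e_ν) − k(x)| ≤ Φ(0)·[(φ0 + φ1)G(0) + Σ_{1≤j<⌊N_ν∕2⌋}(φ(j+1) − φ(j−1))G(j)]`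
# for a transverse weight `Φ ≥ 0` with supersolution defect `C < m` and ANY monotone longitudinal weight `φ`, `G` the cycle kernel at the shifted
# mass `m − C`** — height-free, d-free, volume-uniform; the CAPSTONE of the P-J-1b port (`…KernelMonotone`, `…CycleProfile`, `…CycleComparison`,
# `…WeightedMarginal`, `…CycleWeightedTV`; `…WeightedMass` bounds the remaining sums `Σ Wk` by `W(0)∕λ`): the storey-J (K∇) letter WITH WEIGHTS of the
# pub-balaban NE9 chain (row L13 of `t4/ROUTES-NE9.md`; t4-ne9-idea-1 g129's `weighted_grad_row_le_transverse` ∕ (W-0), Mathlib-only scratch under FREEZE (0),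
# here in the tree's (FS) encoding with unequal periods)

statement-level skeleton of published theorems with citation tags; proofs where landed; nothing here is a claim about the Yang–Mills mass gap

CITATION HEADER (lean-in-tree rule).  Audit cell `pub-balaban`, sub-cell `t4`, BINDER row NE9; filed by NE9 crux-team LEAF PROVER 05
(`b2b-balaban-t4-ne9-formalise-leaf-05`, gen 80).  OBJECT: [Balaban1984PropagatorsI] (1.29) p. 23's free stencil in the (FS) encoding (`Tor N`, `unitVec`,
resolvent equation ∕ weights ∕ the shifted-mass cycle solution as HYPOTHESES; no `def`).  CONTENT: [folklore] composition BY NAME of the five files.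
Mathematics: t4-ne9-idea-1 g129 (credit).  Nothing of print is asserted; no weight is fixed (the product `cosh` weights of `B5Eq129CoshSupersolution` satisfy
the three displayed weight hypotheses with `C = 2t²Σ_{μ≠ν}(cosh a_μ − 1)`).

WHAT IS PROVED (sorry-free; proof lane — 0 `def`).
* **`weighted_sum_abs_sub_le`** — the displayed inequality (`m > 0`, `C < m`, `N_ν ≥ 2`); **`weighted_sum_abs_sub_le_cosh`** — (W-0): `φ = cosh(a·)`,
  `Σ_x cosh(a·d(x_ν))Φ(x)|∇k| ≤ Φ(0)·[(1 + cosh a)G(0) + 2 sinh a·Σ_{1≤j<⌊N_ν∕2⌋} sinh(aj)G(j)]`; **`weighted_sum_abs_sub_le_exp`** — (W-1): `φ = exp(a·)`,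
  `Σ_x e^{a·d(x_ν)}Φ(x)|∇k| ≤ Φ(0)·[(1 + e^a)G(0) + 2 sinh a·Σ_{1≤j<⌊N_ν∕2⌋} e^{aj}G(j)]` (the longitudinal weight an OFF-SLICE centre produces:
  `B5Eq129CoshWeightFactorLetters.cosh_factor_le_exp_mul_centre`).
HONEST SCOPE.  FLAT stencil; abstract transverse weight; (W-0)∕(W-1) keep `G` displayed (the geometric sums against the cycle profile and N23's `S^{cosh}`∕`S^{ctr}` are NOT here).  ONE
letter of ONE un-opened storey (J) of row L13; NOT the ∇-line of (3.42) for `G′_k(U)`, NOT Tier P, NOT NE9 (cell pub-balaban: NE9 NOT PRINTED ∕ NOT PROVED;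
«NE9 ⇐ the named binders»; row WALLED ON A MODEL (O-NE9-1; #5 UNRULED); spine PROVED 0∕9; rung (B)+1 finite T⁴ — NOT infinite volume, NOT mass gap, NOT
BetaPertH, NOT Clay).  HONEST DEPENDENCY: continuum YM on T⁴ ⇐ BetaPertH ∧ nine spine estimates (0/9 proved); BetaPertH ⇐ (D1) ∧ (D4) ∧ CAP+tail; G-an2-4
gates asym, D1 and NE2/3/4.  NEW file importing the five files named and `B5Eq129CoshWeightFactorLetters` (the `exp` letters); nothing modified.  Net new
unproved facts: 0.
-/

noncomputable section

open scoped BigOperators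

namespace Literature.MathematicalPhysics.QuantumFieldTheory.Balaban1983to89.B5Eq129FreeResolventWeightedGradientRow

open B5Prop11Plancherel (Tor unitVec)
open B5Eq129FreeResolventKernelMonotone (nonneg_of_resolvent_nonneg kernel_reflect kernel_sub_unitVec_nonneg dipole_sign_on_fibre)
open B5Eq129FreeResolventCycleProfile (cycle_eq_of_resolvent_eq)
open B5Eq129FreeResolventCycleComparison (cycle_le_mul_of_subsolution)
open B5Eq129FreeResolventWeightedMarginal (wfibre_sub_unitVec weighted_fibreSum_subsolution weighted_sum_abs_sub_eq)
open B5Eq129FreeResolventCycleWeightedTV (weighted_tv_le)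
open B5Eq129CoshWeightFactorLetters (exp_nat_monotone exp_succ_sub_exp_pred)

variable {d : ℕ} (N : Fin d → ℕ)

/-- the coordinate reflection `R_ν` is an involution. [folklore] -/
private theorem reflect_reflect (x : Tor N) (ν : Fin d) :
    Function.update (Function.update x ν (-x ν)) ν (-(Function.update x ν (-x ν)) ν) = x := by
  funext κ
  by_cases hκ : κ = ν
  · subst hκ; rw [Function.update_self, Function.update_self, neg_neg]
  · rw [Function.update_of_ne hκ, Function.update_of_ne hκ]

variable [∀ μ, NeZero (N μ)]

/-- a solution of the cycle equation with source `δ₀` is even. [folklore] -/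
private theorem cycle_solution_even {n : ℕ} [NeZero n] (t : ℝ) {μ : ℝ} (hμ : 0 < μ) {G : ZMod n → ℝ}
    (hG : ∀ s, t ^ 2 * ((G s - G (s - 1)) + (G s - G (s + 1))) + μ * G s = if s = 0 then 1 else 0) (s : ZMod n) :
    G (-s) = G s := by
  have h := cycle_eq_of_resolvent_eq t hμ (φ₁ := fun s => G (-s)) (φ₂ := G) (ψ := fun s => if s = 0 then (1 : ℝ) else 0)
    (fun s => by
      have e := hG (-s)
      simp only [neg_eq_zero] at e
      rw [← e, show -s - 1 = -(s + 1) by ring, show -s + 1 = -(s - 1) by ring]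
      ring) hG
  exact congrFun h s

/-- **THE WEIGHTED ∇-ROW OF THE FREE RESOLVENT KERNEL (abstract transverse weight, abstract longitudinal weight).**  Let `(L₀ + m)k = δ₀` on
`Π_μ ℤ∕N_μ` (weight `t²`, `m > 0`), fix `ν` with `N_ν ≥ 2`.  Let `Φ ≥ 0` be a transverse weight NOT reading `x_ν` (`Φ(x + e_ν) = Φ(x)`,
`Φ(R_ν x) = Φ(x)`) with transverse supersolution defect `C < m` (`−CΦ ≤ Σ_{μ≠ν} t²[(Φ x − Φ(x−e_μ)) + (Φ x − Φ(x+e_μ))]`; product `cosh` weights: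
`C = 2t²Σ_{μ≠ν}(cosh a_μ − 1)`), let `G` solve the cycle equation on `ℤ∕N_ν` at the SHIFTED mass `m − C` (closed form:
`B5Eq129FreeResolventCycleProfile.cycle_profile_eq`), and let `φ ≥ 0` be monotone (longitudinal weight `φ(d_{N_ν}(x_ν))`).  Then
`Σ_x φ(d_{N_ν}(x_ν))·Φ(x)·|k(x − e_ν) − k(x)| ≤ Φ(0)·[(φ0 + φ1)·G(0) + Σ_{1≤j<⌊N_ν∕2⌋}(φ(j+1) − φ(j−1))·G(j)]` — HEIGHT-FREE (every letter is a
cycle-kernel value), uniform in `d` and in the transverse volume.  Composition BY NAME: one sign per fibre and monotonicity (A1) ⟹ weighted collapse and the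
weighted marginal's subsolution property (`…WeightedMarginal`) ⟹ comparison (`…CycleComparison`) ⟹ Abel summation (`…CycleWeightedTV`).  This is
t4-ne9-idea-1 g129's `weighted_grad_row_le_transverse` ∕ (W-0) in the tree's (FS) encoding with UNEQUAL periods; at `φ = cosh(a·)`, `t = η⁻¹`, `m = 1`
and `η⁻¹` in front it is the storey-J (K∇) letter with weights (P-J-1b). [folklore] [cite: Balaban1984PropagatorsI, (1.29) p.23] -/
theorem weighted_sum_abs_sub_le (t : ℝ) {m C : ℝ} (hm : 0 < m) (hCm : C < m) {k Φ : Tor N → ℝ}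
    (hk : ∀ x, ∑ ν, t ^ 2 * ((k x - k (x - unitVec N ν)) + (k x - k (x + unitVec N ν))) + m * k x = if x = 0 then 1 else 0)
    (ν : Fin d) (hn : 2 ≤ N ν) (hΦ0 : ∀ x, 0 ≤ Φ x) (hΦν : ∀ x, Φ (x + unitVec N ν) = Φ x)
    (hΦR : ∀ x, Φ (Function.update x ν (-x ν)) = Φ x)
    (hCT : ∀ x, -(C * Φ x) ≤ ∑ μ ∈ Finset.univ.erase ν, t ^ 2 * ((Φ x - Φ (x - unitVec N μ)) + (Φ x - Φ (x + unitVec N μ))))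
    {G : ZMod (N ν) → ℝ} (hG : ∀ s, t ^ 2 * ((G s - G (s - 1)) + (G s - G (s + 1))) + (m - C) * G s = if s = 0 then 1 else 0)
    (φ : ℕ → ℝ) (hφ0 : ∀ j, 0 ≤ φ j) (hφ : Monotone φ) :
    ∑ x : Tor N, φ (min (x ν).val (N ν - (x ν).val)) * Φ x * |k (x - unitVec N ν) - k x| ≤
      Φ 0 * ((φ 0 + φ 1) * G 0 + ∑ j ∈ Finset.Ico 1 (N ν / 2), (φ (j + 1) - φ (j - 1)) * G (j : ZMod (N ν))) := by
  classical
  have hμ : 0 < m - C := by linarith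
  -- `k ≥ 0`
  have hk0 : ∀ x, 0 ≤ k x := nonneg_of_resolvent_nonneg (V := Tor N) (ι := Fin d) (fun μ y => y - unitVec N μ)
    (fun μ y => y + unitVec N μ) (sq_nonneg t) hm hk (fun x => by split_ifs <;> norm_num)
  -- the period split
  obtain ⟨M, M', hMM', hle, hle'⟩ : ∃ M M' : ℕ, M + M' = N ν ∧ M ≤ M' ∧ M' ≤ M + 1 :=
    ⟨N ν / 2, N ν - N ν / 2, by omega, by omega, by omega⟩
  have hMdef : M = N ν / 2 := by omega
  -- (1) weighted collapse
  have hsign := dipole_sign_on_fibre N t hm hk ν hn M M' hMM' hle hle'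
  have hcoll := weighted_sum_abs_sub_eq N k Φ ν hΦ0 hΦν (fun s => φ (min s.val (N ν - s.val))) hsign
  rw [show (∑ x : Tor N, φ (min (x ν).val (N ν - (x ν).val)) * Φ x * |k (x - unitVec N ν) - k x|) =
      ∑ x : Tor N, (fun s : ZMod (N ν) => φ (min s.val (N ν - s.val))) (x ν) * Φ x * |k (x - unitVec N ν) - k x| from rfl, hcoll]
  -- the weighted profile `h` and its letters
  set h : ZMod (N ν) → ℝ := fun s => ∑ x : Tor N, if x ν = s then Φ x * k x else 0 with hh
  have hHnn : ∀ s, 0 ≤ h s := fun s => Finset.sum_nonneg fun x _ => by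
    split_ifs
    · exact mul_nonneg (hΦ0 x) (hk0 x)
    · exact le_rfl
  have hHeven : ∀ s, h (-s) = h s := by
    intro s
    simp only [hh]
    refine Fintype.sum_equiv (Function.Involutive.toPerm (fun x : Tor N => Function.update x ν (-x ν))
      (fun x => reflect_reflect N x ν)) _ _ fun x => ?_
    show (if x ν = -s then Φ x * k x else 0) =
      (if (Function.update x ν (-x ν)) ν = s then Φ (Function.update x ν (-x ν)) * k (Function.update x ν (-x ν)) else 0)
    rw [Function.update_self, hΦR, kernel_reflect N t hm hk ν x]
    by_cases hx : x ν = -s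
    · rw [if_pos hx, if_pos (by rw [hx, neg_neg])]
    · rw [if_neg hx, if_neg (fun h => hx (by rw [← h, neg_neg]))]
  have hHmono : ∀ s : ZMod (N ν), 1 ≤ s.val → s.val ≤ N ν / 2 → h s ≤ h (s - 1) := by
    intro s h1 h2
    simp only [hh]
    rw [← wfibre_sub_unitVec N k Φ ν hΦν s]
    refine Finset.sum_le_sum fun x _ => ?_
    split_ifs with hx
    · exact mul_le_mul_of_nonneg_left
        (by linarith [kernel_sub_unitVec_nonneg N t hm hk ν M M' hMM' hle hle' x (hx ▸ h1) (hx ▸ (hMdef ▸ h2))]) (hΦ0 x)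
    · exact le_rfl
  have hGeven : ∀ s, G (-s) = G s := cycle_solution_even t hμ hG
  have hHG : ∀ s, h s ≤ Φ 0 * G s :=
    cycle_le_mul_of_subsolution t hμ (Φ 0) (weighted_fibreSum_subsolution N t m C hk hk0 ν hΦν hCT) hG
  -- (2) the weighted total variation bound
  have htv := weighted_tv_le hn hHnn hHeven hHmono hGeven hHG φ hφ0 hφ
  calc ∑ s : ZMod (N ν), φ (min s.val (N ν - s.val)) * |h (s - 1) - h s|
      = ∑ s : ZMod (N ν), φ (min s.val (N ν - s.val)) * |h s - h (s - 1)| :=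
        Finset.sum_congr rfl fun s _ => by rw [abs_sub_comm]
    _ ≤ _ := htv

/-- `cosh` on `ℕ·a`, `a ≥ 0`, is a nonnegative monotone longitudinal weight. [folklore] -/
private theorem cosh_nat_monotone {a : ℝ} (ha : 0 ≤ a) : Monotone fun j : ℕ => Real.cosh (a * j) := by
  intro i j hij
  simp only
  rw [Real.cosh_le_cosh, abs_of_nonneg (by positivity), abs_of_nonneg (by positivity)]
  exact mul_le_mul_of_nonneg_left (by exact_mod_cast hij) ha

/-- **(W-0) THE `cosh` LONGITUDINAL WEIGHT.**  `weighted_sum_abs_sub_le` at `φ(j) = cosh(a·j)`, `a ≥ 0`, with the increments evaluated by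
`cosh(a(j+1)) − cosh(a(j−1)) = 2·sinh(a)·sinh(a·j)`:
`Σ_x cosh(a·d_{N_ν}(x_ν))·Φ(x)·|k(x − e_ν) − k(x)| ≤ Φ(0)·[(1 + cosh a)·G(0) + 2 sinh a · Σ_{1≤j<⌊N_ν∕2⌋} sinh(a·j)·G(j)]` — t4-ne9-idea-1 g129's
`weighted_grad_row_le_torus_cosh` (W-0) in the (FS) encoding (the `η⁻¹` in front and the closed-form geometric sums at `G` = the cycle profile are the
consumer's arithmetic). [folklore] [cite: Balaban1984PropagatorsI, (1.29) p.23] -/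
theorem weighted_sum_abs_sub_le_cosh (t : ℝ) {m C : ℝ} (hm : 0 < m) (hCm : C < m) {k Φ : Tor N → ℝ}
    (hk : ∀ x, ∑ ν, t ^ 2 * ((k x - k (x - unitVec N ν)) + (k x - k (x + unitVec N ν))) + m * k x = if x = 0 then 1 else 0)
    (ν : Fin d) (hn : 2 ≤ N ν) (hΦ0 : ∀ x, 0 ≤ Φ x) (hΦν : ∀ x, Φ (x + unitVec N ν) = Φ x)
    (hΦR : ∀ x, Φ (Function.update x ν (-x ν)) = Φ x)
    (hCT : ∀ x, -(C * Φ x) ≤ ∑ μ ∈ Finset.univ.erase ν, t ^ 2 * ((Φ x - Φ (x - unitVec N μ)) + (Φ x - Φ (x + unitVec N μ))))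
    {G : ZMod (N ν) → ℝ} (hG : ∀ s, t ^ 2 * ((G s - G (s - 1)) + (G s - G (s + 1))) + (m - C) * G s = if s = 0 then 1 else 0)
    {a : ℝ} (ha : 0 ≤ a) :
    ∑ x : Tor N, Real.cosh (a * (min (x ν).val (N ν - (x ν).val) : ℕ)) * Φ x * |k (x - unitVec N ν) - k x| ≤
      Φ 0 * ((1 + Real.cosh a) * G 0 +
        2 * Real.sinh a * ∑ j ∈ Finset.Ico 1 (N ν / 2), Real.sinh (a * j) * G (j : ZMod (N ν))) := by
  have h := weighted_sum_abs_sub_le N t hm hCm hk ν hn hΦ0 hΦν hΦR hCT hG (fun j : ℕ => Real.cosh (a * j))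
    (fun j => (Real.cosh_pos _).le) (cosh_nat_monotone ha)
  simp only [Nat.cast_zero, mul_zero, Real.cosh_zero, Nat.cast_one, mul_one] at h
  refine h.trans (le_of_eq ?_)
  congr 1
  rw [add_comm (1 : ℝ) (Real.cosh a), Finset.mul_sum]
  congr 1
  refine Finset.sum_congr rfl fun j hj => ?_
  rw [Finset.mem_Ico] at hj
  have e : Real.cosh (a * ((j + 1 : ℕ) : ℝ)) - Real.cosh (a * ((j - 1 : ℕ) : ℝ)) = 2 * Real.sinh a * Real.sinh (a * j) := by
    rw [Nat.cast_sub hj.1]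
    push_cast
    rw [show a * ((j : ℝ) + 1) = a * j + a by ring, show a * ((j : ℝ) - 1) = a * j - a by ring, Real.cosh_add, Real.cosh_sub]
    ring
  rw [e]; ring

/-- **(W-1) THE `exp` LONGITUDINAL WEIGHT.**  `weighted_sum_abs_sub_le` at `φ(j) = e^{a·j}`, `a ≥ 0`, with the increments evaluated by
`e^{a(j+1)} − e^{a(j−1)} = 2·sinh(a)·e^{a·j}` (`B5Eq129CoshWeightFactorLetters.exp_succ_sub_exp_pred`):
`Σ_x e^{a·d_{N_ν}(x_ν)}·Φ(x)·|k(x − e_ν) − k(x)| ≤ Φ(0)·[(1 + e^a)·G(0) + 2 sinh a · Σ_{1≤j<⌊N_ν∕2⌋} e^{a·j}·G(j)]` — t4-ne9-idea-1 g129's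
`weighted_grad_row_le_torus_exp` (W-1) in the (FS) encoding; this is the longitudinal weight that an OFF-SLICE centre of the product `cosh` weight produces
(`B5Eq129CoshWeightFactorLetters.cosh_factor_le_exp_mul_centre`), so it is the form the (W-1′) junction consumes. [folklore] [cite: Balaban1984PropagatorsI, (1.29) p.23, p.36] -/
theorem weighted_sum_abs_sub_le_exp (t : ℝ) {m C : ℝ} (hm : 0 < m) (hCm : C < m) {k Φ : Tor N → ℝ}
    (hk : ∀ x, ∑ ν, t ^ 2 * ((k x - k (x - unitVec N ν)) + (k x - k (x + unitVec N ν))) + m * k x = if x = 0 then 1 else 0)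
    (ν : Fin d) (hn : 2 ≤ N ν) (hΦ0 : ∀ x, 0 ≤ Φ x) (hΦν : ∀ x, Φ (x + unitVec N ν) = Φ x)
    (hΦR : ∀ x, Φ (Function.update x ν (-x ν)) = Φ x)
    (hCT : ∀ x, -(C * Φ x) ≤ ∑ μ ∈ Finset.univ.erase ν, t ^ 2 * ((Φ x - Φ (x - unitVec N μ)) + (Φ x - Φ (x + unitVec N μ))))
    {G : ZMod (N ν) → ℝ} (hG : ∀ s, t ^ 2 * ((G s - G (s - 1)) + (G s - G (s + 1))) + (m - C) * G s = if s = 0 then 1 else 0)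
    {a : ℝ} (ha : 0 ≤ a) :
    ∑ x : Tor N, Real.exp (a * (min (x ν).val (N ν - (x ν).val) : ℕ)) * Φ x * |k (x - unitVec N ν) - k x| ≤
      Φ 0 * ((1 + Real.exp a) * G 0 +
        2 * Real.sinh a * ∑ j ∈ Finset.Ico 1 (N ν / 2), Real.exp (a * j) * G (j : ZMod (N ν))) := by
  have h := weighted_sum_abs_sub_le N t hm hCm hk ν hn hΦ0 hΦν hΦR hCT hG (fun j : ℕ => Real.exp (a * j))
    (fun j => (Real.exp_pos _).le) (exp_nat_monotone ha)
  simp only [Nat.cast_zero, mul_zero, Real.exp_zero, Nat.cast_one, mul_one] at h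
  refine h.trans (le_of_eq ?_)
  congr 1
  rw [Finset.mul_sum]
  congr 1
  refine Finset.sum_congr rfl fun j hj => ?_
  rw [Finset.mem_Ico] at hj
  rw [exp_succ_sub_exp_pred hj.1]
  ring

end Literature.MathematicalPhysics.QuantumFieldTheory.Balaban1983to89.B5Eq129FreeResolventWeightedGradientRow

end
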